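import Summits.KontsevichZagierPeriods.KontsevichZagierPeriods.Theses.SymplecticScissors
import Summits.KontsevichZagierPeriods.KontsevichZagierPeriods.Theorems.LiftingCriteriaCubeNashNormalFormDimLeOne

/-!
# Sketch (crux-ideate, ideator 2) — first lemmas for the cards
`cellular-delta-extension` and `generic-rational-walls` on crux `CubeNashNormalForm`
(stmt-KontsevichZagierPeriods-3574). Definitions only; nothing is proved here.
-/

noncomputable section

open Set MeasureTheory
open Literature.ModelTheory.ExponentialFields (IsSemialgebraic)
open Literature.NumberTheory.Transcendental
open Literature.NumberTheory.Transcendental.KZ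

namespace Summit.KontsevichZagierPeriods.KontsevichZagierPeriods.Cruxes.CubeNashNormalForm.SketchTwo

/-- The open unit cube `(0,1)^N`. -/
def openCube (N : ℕ) : Set (Fin N → ℝ) := {z | ∀ l, 0 < z l ∧ z l < 1}

/-- The closed unit cube `[0,1]^N` (the domain of the crux's cube–Nash generators). -/
def closedCube (N : ℕ) : Set (Fin N → ℝ) := Set.pi Set.univ (fun _ : Fin N => Set.Icc (0:ℝ) 1)

/-- `f` depends only on the coordinates strictly below `i` (triangularity of cellular data). -/
def DependsOnlyBelow {N : ℕ} (i : Fin N) (f : (Fin N → ℝ) → ℝ) : Prop :=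
  ∀ x y : Fin N → ℝ, (∀ l : Fin N, l < i → x l = y l) → f x = f y

/-- The **prepared triangular chart** of Binyamini–Novikov type built from exponents `q` and
triangular data `a, b, c`: coordinate `i` is `(a i x + x i * b i x) ^ q i + c i x`
(straightened positive real cell composed with a prepared cellular map `w_i = z_i^{q_i} + φ_i`).
Its Jacobian determinant is the explicit product `∏ i, q i * (a i x + x i * b i x)^(q i - 1) * b i x`. -/
def preparedChart {N : ℕ} (q : Fin N → ℕ) (a b c : Fin N → (Fin N → ℝ) → ℝ) :
    (Fin N → ℝ) → (Fin N → ℝ) :=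
  fun x i => (a i x + x i * b i x) ^ (q i) + c i x

/-- **Card `cellular-delta-extension`, first lemma (DISJOINT REAL CELLULAR COVER, straightened).**
Transcription of Binyamini–Novikov, *Complex cellular structures* (Ann. Math. 190, 2019),
Cor. 34 (real CPT for semialgebraic sets: prepared real cellular maps `f_j : C_j^σ → P_N^ρ`,
`f_j(ℝ₊C_j^σ) ⊆ S`, `⋃ f_j(ℝ₊C_j) = S`, each `f_j` a real-analytic diffeomorphism of `ℝ₊C_j`
onto a cylindrical cell, holomorphic on the `σ`-extension) in the DISJOINT algebraic form
(Shankar 2025; Binyamini–Carmon–Novikov arXiv:2603.25380, Rem. 4.4: images of positive real parts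
pairwise disjoint; cells definable in the same reduct, here semialgebraic), after straightening
each positive real cell `ℝ₊C_j` to the unit cube affinely in the fibres: every open
`ℚ`-semialgebraic `S ⊆ (0,1)^N` is, up to a null set, the disjoint union of images of `(0,1)^N`
under prepared triangular charts whose data are `ℚ`-semialgebraic and real-analytic on a
neighbourhood of the CLOSED cube (the `σ`-extension), injective on the open cube. -/
def DisjointRealCellularCover : Prop :=
  ∀ (N : ℕ) (S : Set (Fin N → ℝ)), IsSemialgebraic ℚ S → IsOpen S → S ⊆ openCube N →
    ∃ (n : ℕ) (q : Fin n → Fin N → ℕ) (a b c : Fin n → Fin N → (Fin N → ℝ) → ℝ)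
      (U : Fin n → Set (Fin N → ℝ)),
      (∀ j, IsOpen (U j) ∧ closedCube N ⊆ U j ∧
        (∀ i, 0 < q j i ∧ DependsOnlyBelow i (a j i) ∧ DependsOnlyBelow i (b j i) ∧
          DependsOnlyBelow i (c j i) ∧
          IsSemialgebraicFunOn ℚ (U j) (a j i) ∧ AnalyticOnNhd ℝ (a j i) (U j) ∧
          IsSemialgebraicFunOn ℚ (U j) (b j i) ∧ AnalyticOnNhd ℝ (b j i) (U j) ∧
          IsSemialgebraicFunOn ℚ (U j) (c j i) ∧ AnalyticOnNhd ℝ (c j i) (U j) ∧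
          (∀ x ∈ U j, 0 ≤ a j i x ∧ 0 < b j i x)) ∧
        InjOn (preparedChart (q j) (a j) (b j) (c j)) (openCube N) ∧
        preparedChart (q j) (a j) (b j) (c j) '' openCube N ⊆ S) ∧
      (∀ j j', j ≠ j' → Disjoint (preparedChart (q j) (a j) (b j) (c j) '' openCube N)
        (preparedChart (q j') (a j') (b j') (c j') '' openCube N)) ∧
      volume (S \ ⋃ j, preparedChart (q j) (a j) (b j) (c j) '' openCube N) = 0

/-- The residual statement `H` of the crux (hypothesis of the landed
`CubeNashNormalFormDimLeOne.cubeNashNormalForm_of_volume_three`): cube–Nash normal form of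
bounded integrand-1 solids of dimension `m + 3`. -/
def VolumeNF : Prop :=
  ∀ (m : ℕ) (K : IntegralRep (m + 3)), Bornology.IsBounded K.domain →
    (∀ x ∈ K.domain, K.integrand x = 1) →
    ∃ (S : ℕ) (n : Fin S → ℕ) (g : (i : Fin S) → (Fin (n i) → ℝ) → ℝ)
      (U : (i : Fin S) → Set (Fin (n i) → ℝ)) (ε : Fin S → ℤ) (s : (i : Fin S) → IntegralRep (n i)),
      (∀ i, IsOpen (U i) ∧ Set.pi Set.univ (fun _ : Fin (n i) => Set.Icc (0:ℝ) 1) ⊆ (U i) ∧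
        IsSemialgebraicFunOn ℚ (U i) (g i) ∧ AnalyticOnNhd ℝ (g i) (U i)) ∧
      (∀ i, (s i).domain = Set.pi Set.univ (fun _ : Fin (n i) => Set.Icc (0:ℝ) 1) ∧
        ∀ z ∈ Set.pi Set.univ (fun _ : Fin (n i) => Set.Icc (0:ℝ) 1), (s i).integrand z = g i z) ∧
      of K - ∑ i, ε i • of (s i) ∈ relations

/-- The landed reduction, restated: `VolumeNF` gives the crux (both route copies are the same
`Prop`). -/
theorem crux_of_volumeNF (h : VolumeNF) :
    Summit.KontsevichZagierPeriods.KontsevichZagierPeriods.Theses.SymplecticScissors.CubeNashNormalForm :=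
  Summit.KontsevichZagierPeriods.LiftingCriteria.CubeNashNormalFormDimLeOne.cubeNashNormalForm_of_volume_three h

/-- **Card `cellular-delta-extension`, shape of the line**: the cover lemma plus the (provable-now)
bookkeeping `PreparedChartsToNormalForm` give `VolumeNF`. Stated as a `Prop`, not proved here. -/
def PreparedChartsToNormalForm : Prop := DisjointRealCellularCover → VolumeNF

/-! ### Card `generic-rational-walls` -/

/-- Normal-crossings condition for the analytic hypersurfaces `{h l = 0}` at `x`: the differentials
of those `h l` vanishing at `x` are linearly independent. -/
def NcAt {N L : ℕ} (h : Fin L → (Fin N → ℝ) → ℝ) (x : Fin N → ℝ) : Prop :=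
  LinearIndependent ℝ (fun l : {l : Fin L // h l x = 0} => fderiv ℝ (h l.1) x)

/-- **Card `generic-rational-walls`, first lemma (NC-SHEETED REGIONS ARE CUBE-DECOMPOSABLE).**
A bounded open `ℚ`-semialgebraic region whose frontier lies in a normal-crossings arrangement of
finitely many `ℚ`-semialgebraic hypersurfaces real-analytic on a neighbourhood of its closure is,
up to a null set, a finite disjoint union of images of the open cube under `ℚ`-semialgebraic charts
real-analytic on a neighbourhood of the closed cube and injective on the open cube (fine generic
rational grid + graph-direction induction on `N`; no blow-up, no Puiseux). -/
def NcRegionCubes : Prop :=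
  ∀ (N L : ℕ) (R V : Set (Fin N → ℝ)) (h : Fin L → (Fin N → ℝ) → ℝ),
    IsOpen R → IsOpen V → Bornology.IsBounded R → closure R ⊆ V → IsSemialgebraic ℚ R →
    (∀ l, IsSemialgebraicFunOn ℚ V (h l) ∧ AnalyticOnNhd ℝ (h l) V) →
    frontier R ⊆ (⋃ l, {x | h l x = 0}) → (∀ x ∈ V, NcAt h x) →
    ∃ (n : ℕ) (Φ : Fin n → (Fin N → ℝ) → (Fin N → ℝ)) (U : Fin n → Set (Fin N → ℝ)),
      (∀ j, IsOpen (U j) ∧ closedCube N ⊆ U j ∧ IsSemialgebraicMapOn ℚ (U j) (Φ j) ∧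
        AnalyticOnNhd ℝ (Φ j) (U j) ∧ InjOn (Φ j) (openCube N) ∧ Φ j '' openCube N ⊆ R) ∧
      (∀ j j', j ≠ j' → Disjoint (Φ j '' openCube N) (Φ j' '' openCube N)) ∧
      volume (R \ ⋃ j, Φ j '' openCube N) = 0

/-- **Card `generic-rational-walls`, the genericity tool (NASH–SARD, finiteness of critical
values).** A `ℚ`-semialgebraic real-analytic function on an open `ℚ`-semialgebraic set has only
finitely many critical values (so a wall `{h = c}` with rational `c` off a finite set is smooth, and —
applied on strata — transversal to a fixed finite Nash stratification). -/
def NashSardFinite : Prop :=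
  ∀ (N : ℕ) (V : Set (Fin N → ℝ)) (f : (Fin N → ℝ) → ℝ), IsOpen V → IsSemialgebraic ℚ V →
    IsSemialgebraicFunOn ℚ V f → AnalyticOnNhd ℝ f V →
    Set.Finite {c : ℝ | ∃ x ∈ V, f x = c ∧ fderiv ℝ f x = 0}

/-- **Card `generic-rational-walls`, shape of the line**: local desingularization by smooth-centre
local blowings-up (Bierstone–Milman 1988, Thm 4.4, in the `ℚ`-Nash category) + generic rational
walls (`NashSardFinite` on strata) turn `K.domain` into finitely many nc-sheeted leaf regions with
analytic Jacobian weights; `NcRegionCubes` finishes. Stated as a `Prop`, not proved here. -/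
def WallsLine : Prop := NashSardFinite → NcRegionCubes → VolumeNF

end Summit.KontsevichZagierPeriods.KontsevichZagierPeriods.Cruxes.CubeNashNormalForm.SketchTwo
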